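import Summits.AtomisticToContinuum.HydrodynamicLimit.Theorems.InformationPercolationEngineKickFairRelEquilibriumMesoConditionThePastDefs
import Summits.AtomisticToContinuum.HydrodynamicLimit.Theorems.InformationPercolationEngineKickFairRelEquilibriumMesoReductionA
import Summits.AtomisticToContinuum.HydrodynamicLimit.Theorems.InformationPercolationEngineKickFairRelEquilibriumMesoReductionB
import Summits.AtomisticToContinuum.HydrodynamicLimit.Theorems.InformationPercolationEngineKickFairRelEquilibriumMesoPairExpansion
import Summits.AtomisticToContinuum.HydrodynamicLimit.Theorems.InformationPercolationEngineKickFairRelEquilibriumMesoSingleKickBiasNecessary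
import Summits.AtomisticToContinuum.HydrodynamicLimit.Theorems.InformationPercolationEngineKickFairRelEquilibriumMesoUnorderedPairWeight
import Summits.AtomisticToContinuum.HydrodynamicLimit.Theorems.InformationPercolationEngineKickFairRelEquilibriumMesoTruncatedFluctuationNecessary
import Summits.AtomisticToContinuum.HydrodynamicLimit.Theorems.InformationPercolationEngineKickFairRelEquilibriumMesoTruncatedFluctuationLG
import Summits.AtomisticToContinuum.HydrodynamicLimit.Theorems.InformationPercolationEngineKickFairRelEquilibriumMesoPairExpansion2
import Summits.AtomisticToContinuum.HydrodynamicLimit.Theorems.InformationPercolationEngineKickFairRelEquilibriumMesoReductionB2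
import Summits.AtomisticToContinuum.HydrodynamicLimit.Theorems.KickFairRelEquilibriumMeso.Negative.WindowAlgebra
import HarnessLib

/-!
# Line `condition-the-past` for the crux `KickFairRelEquilibriumMeso`
# (stmt-AtomisticToContinuum-15177, route `InformationPercolationEngine`, rank 2) — checked skeleton, rev 4 (lead c7, 2026-08-17)

The crux: `∃ rs` admissible (`rs N > 0`, `rs N → 0`, `(N+1)(rs N)³ → ∞`) such that under the LOCAL Gibbs law
`LG = localGibbsLaw σ a₀ u₀ θ₀ N (Φ N)` the past-weighted, EQUILIBRIUM-centred kick sum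
`S_h = (ε/(N+1)) Σ_i Σ_{n<cnt_i} h_{i,n}(P_{i,n}) (g(X_{i,n}) − κ_{i,n})` (`κ` = condExp under the INVARIANT law
`G = localGibbsLaw σ 1 0 1 N (Φ N)` given the comap σ-algebra of the typed past) has `E_LG |S_h| ≤ δ` eventually in `N`,
uniformly over measurable `|h| ≤ 1`.

## The line (card `Ideas/condition-the-past.md`; strategist's skeleton rev 1, 2026-08-17T04:05Z; lead's rev 2, 05:00Z)

ARCHITECTURE WITHOUT TRANSFER AND WITHOUT LARGE DEVIATIONS: every conditioning is done UNDER `LG` ITSELF, on the crux's own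
typed pasts. Write `D_c := g(X_c) − κ_c` (`kickDev`), `β_c := E_LG[D_c | σ(P_c)]` (`betaLG`), `ξ_c := D_c − β_c`; then
`|S_h| ≤ (ε/(N+1)) Σ_c |β_c| + |(ε/(N+1)) Σ_c h_c ξ_c|`.

## REV 3 — WHAT WAVE 1 ESTABLISHED (seven workers, 2026-08-17T05:00–09:50Z; everything below is LANDED, sorry-free)

* `stub_reductionA` (p143726): `SingleKickBias rs → CountExcessLG → TruncatedFluctuation rs → MesoBody rs` (B1 ∧ CT-a ∧ TF ⟹ body).
* `stub_pairExpansion` (p144672): the abstract pair expansion PE; `stub_reductionB` (p146001 + p146871):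
  `PairExpansion → PairInnovationBias rs → UnorderedPairWeight rs → TruncatedFluctuation rs` (PE ∧ B2′ ∧ CT-b ⟹ TF).
* `unorderedPairWeight_of_countExcessLG` (p152002 + p152437): CT-b ⟸ CT-a EXACTLY, by a pathwise count (an unordered pair has
  one collision time inside one of the two flight windows of the other; an instant lies in ≤ 2 flights of a given sphere;
  `(i',n') ↦ (partner, time)` is injective) — `#unordered ≤ 8(N+1)Σ_i cnt_i`, weight `≤ 8ε_N ·` normalised count. CT-b is GONE.
* `singleKickBias_of_mesoBody` (p150031): B1 is NECESSARY for the crux body (`h :=` sign of a Doob–Dynkin version of `β`).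
* `countExcessLG_of_shortFlightLG`, `countExcessLG_const` (p148642): CT-a ⟸ the dead line's U (`stub_shortFlightLG`) exactly, and
  CT-a holds at constant profiles (invariant law) — its open content is the non-equilibrium count transfer only.
* Assessments (workers B1, B2′, CT-a): B1 = positive-time one-sided chaos at fixed density (open, no fact in print); B2′ open even at
  constant profiles (equilibrium one-kick merging for the deterministic `N`-sphere flow; 2 bodies only in print); CT-a = U-class.

## REV 4 — WHAT WAVE 2 ESTABLISHED (five workers, 10:10–11:20Z; all LANDED, sorry-free; Defs rev 2 = p152855)

* `truncatedFluctuation_of_mesoBody` (p153252): TF is NECESSARY for the crux body (`|TF-sum_h| ≤ |S_{h·1_{n<M}}| + (ε/(N+1))ΣΣ|β|` and B1's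
  necessity). Hence, GIVEN the count debt CT-a, THE CRUX BODY IS EQUIVALENT TO `B1 ∧ TF` (`mesoBody_iff_of_countExcessLG` below).
* `truncatedFluctuation_iff_centredLG` (p153431): TF equals its `κ`-FREE form `TruncatedFluctuationLG` (each kick centred at its OWN
  `LG`-conditional mean; `kickDev_sub_betaLG_ae_eq`: the equilibrium kernel is `σ(P)`-measurable and cancels) — TF is an `LG`-ONLY law of
  large numbers; all the `LG`-versus-`G` content of the crux sits in B1.
* `stub_pairExpansion2` (p153806) + `truncatedFluctuation_of_pairCondCov` (p154206): the pair route re-typed on the JOIN of the two pasts —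
  `TF ⟸ PE″ ∧ B2″ ∧ CT-b`, `B2″ = PairCondCov` (conditional covariance of two time-ordered centred kicks given the join of their typed pasts;
  no outcome enrichment, no Jensen step); `pairCondCov_of_pairInnovationBias` (p155051): `B2′ ⟹ B2″` (tower property), so B2″ is the weaker,
  closest-to-necessary h-free pair typing on file. B2″ is open even at constant profiles (equilibrium two-time conditional decorrelation of
  kicks for the deterministic `N`-sphere flow; two bodies only in print).

* Wave 3: `betaLG_const_ae_eq_zero` (p156240): at CONSTANT profiles `β = 0` a.e. (B1 holds trivially at equilibrium: `dLG/dG` is a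
  function of the conserved total momentum/energy read off the past's exact velocities); with `countExcessLG_const` (p148642) the crux
  body restricted to constant profiles is EXACTLY TF at constant profiles (equilibrium kick decorrelation — open).

CONSEQUENCE FOR THE SKELETON (rev 3 = rev 4 stub set). The registered stubs are exactly {B1, TF, CT-a}: no stub is harder than the crux
(B1 and TF are necessary; CT-a is the universal count debt, true at constant profiles), and the two physical contents are SEPARATED —
* B1 `stub_singleKickBias` — the evolved conditional kick law has the EQUILIBRIUM conditional mean (all the `LG`-vs-`G` content);
* TF `stub_truncatedFluctuation` — kicks centred at their own `LG`-conditional mean obey a law of large numbers uniformly over past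
  weights (`LG`-only); landed SUFFICIENT routes: `TF ⟸ B2″ ∧ CT-a` (`truncatedFluctuation_of_pairCondCov'` below) and `B2″ ⟸ B2′`;
* CT-a `stub_countExcessLG` — the `LG`-mean count excess (U-class; `⟸ stub_shortFlightLG` of the dead line, `countExcessLG_of_shortFlightLG`).
Every glue theorem is landed; the only `sorry`s in this file are the three physical stubs. The planner's approved next move
(`STRATEGY-CENSUS.md` §7 R1) is now typed and machine-checked in its sharpest form: `route edit --split KickFairRelEquilibriumMeso --into
{SingleKickBias, TruncatedFluctuation (state it in the κ-free form TruncatedFluctuationLG), CountExcessLG}` with glue `stub_reductionA`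
(p143726) and the converse necessities p150031 / p153252 on record.

## Disproof used
`Cruxes/KickFairRelEquilibriumMeso/Disproof.lean` (cdisprove c1; D0–D5, §1–§8; unchanged since 2026-08-16T14:40Z) carries NO
`_false_without_<H>` theorem and no `-- Targets` for this decl: nothing to honour by a named stub. D2's Bayes identity is the
necessity half of B1 (now a landed theorem, p150031); D4 (no statement about `G`-cheap preparations) is met by design; D1 (window
algebra) supplies `MesoBody`/`kickFairRelEquilibriumMeso_iff`; the enumeration-recycling debt is paid inside `stub_reductionB` /
`singleKickBias_of_mesoBody` by the landed NoLastCollision file moved to `LG` by mutual absolute continuity.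
-/

noncomputable section

open MeasureTheory Set Filter Topology
open scoped ENNReal Classical

namespace Summit.AtomisticToContinuum.HydrodynamicLimit.Cruxes.KickFairRelEquilibriumMeso.ConditionThePastLine

open Literature.Analysis.FluidPDE Literature.MathematicalPhysics.KineticTheory
open Summit.AtomisticToContinuum.HydrodynamicLimit.Theorems.KickFairRelEquilibriumMesoLine
  (Past Phase Flow cnt past kick kappa tN rs rs_pos tendsto_rs tendsto_succ_mul_rs_pow_three
    kickDev betaLG betaLG2 Precedes SingleKickBias PairInnovationBias CountExcessLG UnorderedPairWeight
    TruncatedFluctuation PairExpansion singleKickBias_of_mesoBody TruncatedFluctuationLG PairCondCov PairExpansion2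
    unorderedPairWeight_of_countExcessLG truncatedFluctuation_of_mesoBody truncatedFluctuation_iff_centredLG
    stub_pairExpansion2 truncatedFluctuation_of_pairCondCov)
open Summit.AtomisticToContinuum.HydrodynamicLimit.Theorems.KickFairRelEquilibriumMesoNegative
  (KickBoundRel MesoBody LowerEdge kickFairRelEquilibriumMeso_iff)

/-! ## Registered stubs (`Holds.stub_*`, bodies `sorry`) -/

namespace Holds

/-- **STUB B1 `stub_singleKickBias` — the necessary core (Boltzmann-property class at macroscopic times; OPEN).**
`E_LG[(ε/(N+1)) Σ_i Σ_{n<cnt_i} |E_LG[g(X_{i,n}) − κ_{i,n} | σ(P_{i,n})]|] → 0` along `rs`. Necessary (`singleKickBias_of_mesoBody`,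
p150031); trivial at constant profiles (`dLG/dG` is a function of the conserved totals read off the past); open for genuine profiles. -/
theorem stub_singleKickBias : SingleKickBias rs := by
  sorry

/-- **STUB TF `stub_truncatedFluctuation` — the index-truncated, `LG`-conditionally-centred, past-weighted kick sum is small in
`L¹(LG)` uniformly over measurable `|h| ≤ 1` (OPEN; necessary for the crux given B1 — wave 2 lands `truncatedFluctuation_of_mesoBody`).**
See `TruncatedFluctuation`. An `LG`-only law of large numbers (the equilibrium kernel `κ` cancels inside `ξ = D − β`). Landed sufficient
route: `truncatedFluctuation_of_pairInnovationBias` (PE ∧ B2′ ∧ CT-a ⟹ TF), B2′ open. -/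
theorem stub_truncatedFluctuation : TruncatedFluctuation rs := by
  sorry

/-- **STUB CT-a `stub_countExcessLG` — `LG`-mean excess of per-sphere collision counts over `A(N+1)^{1/3}` (OPEN, `LG`-native,
U-class, mean form).** See `CountExcessLG`. Equivalent in substance to the dead line's `stub_shortFlightLG`
(`countExcessLG_of_shortFlightLG`, p148642); true at constant profiles (`countExcessLG_const`). -/
theorem stub_countExcessLG : CountExcessLG := by
  sorry

end Holds

/-! ## Stub statements by name (D-0027 §3.3: the hypotheses of `_of` are these `Prop`s) -/

/-- Statement of the registered stub `Holds.stub_singleKickBias`, by name. -/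
def stub_singleKickBias : Prop := type_of% Holds.stub_singleKickBias
/-- Statement of the registered stub `Holds.stub_truncatedFluctuation`, by name. -/
def stub_truncatedFluctuation : Prop := type_of% Holds.stub_truncatedFluctuation
/-- Statement of the registered stub `Holds.stub_countExcessLG`, by name. -/
def stub_countExcessLG : Prop := type_of% Holds.stub_countExcessLG

/-! ## Landed glue, by name (sorry-free) -/

/-- **The landed sufficient route to TF**: the abstract pair expansion (`stub_pairExpansion`, p144672), the pair innovation bound
B2′ and the count excess CT-a give the truncated fluctuation bound (`stub_reductionB`, p146871, with CT-b discharged from CT-a by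
`unorderedPairWeight_of_countExcessLG`, p152437). [folklore] -/
theorem truncatedFluctuation_of_pairInnovationBias (hB2 : PairInnovationBias rs) (hCa : CountExcessLG) :
    TruncatedFluctuation rs :=
  Summit.AtomisticToContinuum.HydrodynamicLimit.Theorems.KickFairRelEquilibriumMesoLine.stub_reductionB
    Summit.AtomisticToContinuum.HydrodynamicLimit.Theorems.KickFairRelEquilibriumMesoLine.stub_pairExpansion hB2
    (unorderedPairWeight_of_countExcessLG rs hCa)

/-- **B1 is necessary** (landed, p150031): the crux body along `rs` implies the single-kick conditional bias bound. [folklore] -/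
theorem singleKickBias_of_body (hB : MesoBody rs) : SingleKickBias rs :=
  singleKickBias_of_mesoBody hB

/-- **TF is necessary** (landed, p153252): the crux body along `rs` implies the truncated fluctuation bound. [folklore] -/
theorem truncatedFluctuation_of_body (hB : MesoBody rs) : TruncatedFluctuation rs :=
  truncatedFluctuation_of_mesoBody hB

/-- **Given the count debt, the crux body is equivalent to B1 ∧ TF** (`stub_reductionA` p143726 one way; the two necessities
p150031 / p153252 the other). [folklore] -/
theorem mesoBody_iff_of_countExcessLG (hCa : CountExcessLG) : MesoBody rs ↔ SingleKickBias rs ∧ TruncatedFluctuation rs :=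
  ⟨fun hB => ⟨singleKickBias_of_mesoBody hB, truncatedFluctuation_of_mesoBody hB⟩, fun h =>
    Summit.AtomisticToContinuum.HydrodynamicLimit.Theorems.KickFairRelEquilibriumMesoLine.stub_reductionA h.1 hCa h.2⟩

/-- **TF is an `LG`-only statement** (landed, p153431): it is equivalent to its `κ`-free form. [folklore] -/
theorem truncatedFluctuation_iff_LG : TruncatedFluctuation rs ↔ TruncatedFluctuationLG rs :=
  truncatedFluctuation_iff_centredLG rs

/-- **The sharpest landed sufficient route to TF**: the pair conditional covariance B2″ and the count excess CT-a (PE″ p153806,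
Red-B″ p154206, CT-b from CT-a p152437). [folklore] -/
theorem truncatedFluctuation_of_pairCondCov' (hB2 : PairCondCov rs) (hCa : CountExcessLG) : TruncatedFluctuation rs :=
  truncatedFluctuation_of_pairCondCov stub_pairExpansion2 hB2 (unorderedPairWeight_of_countExcessLG rs hCa)

/-! ## Composition (sorry-free): the stubs ⟹ the crux BY NAME -/

/-- **The skeleton theorem.** The crux from the registered stubs: the landed first half of the reduction (`stub_reductionA`, p143726)
turns B1, CT-a and TF into the body of the crux along `rs N = (N+1)^{-1/4}`; the landed window algebra (`kickFairRelEquilibriumMeso_iff`,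
p109023) with the landed admissibility of the witness (`rs_pos`, `tendsto_rs`, `tendsto_succ_mul_rs_pow_three`, p109029) closes the
`∃ rs` prefix. -/
theorem KickFairRelEquilibriumMeso_of (hB1 : stub_singleKickBias) (hTF : stub_truncatedFluctuation) (hCa : stub_countExcessLG) :
    Summit.AtomisticToContinuum.HydrodynamicLimit.Theses.InformationPercolationEngine.KickFairRelEquilibriumMeso :=
  kickFairRelEquilibriumMeso_iff.2
    ⟨rs, rs_pos, tendsto_rs, tendsto_succ_mul_rs_pow_three,
      Summit.AtomisticToContinuum.HydrodynamicLimit.Theorems.KickFairRelEquilibriumMesoLine.stub_reductionA hB1 hCa hTF⟩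

/-- D-0027 §3.3 shape: the crux from the registered stubs — an `example`, so that `KickFairRelEquilibriumMeso_of` stays the
unique theorem concluding the crux; it becomes the proof of the item once every `sorry` of `Holds.stub_*` is discharged. -/
example :
    Summit.AtomisticToContinuum.HydrodynamicLimit.Theses.InformationPercolationEngine.KickFairRelEquilibriumMeso :=
  KickFairRelEquilibriumMeso_of Holds.stub_singleKickBias Holds.stub_truncatedFluctuation Holds.stub_countExcessLG

end Summit.AtomisticToContinuum.HydrodynamicLimit.Cruxes.KickFairRelEquilibriumMeso.ConditionThePastLine

end
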